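/-
Copyright (c) 2026. All rights reserved.
Released under Apache 2.0 license as described in the file LICENSE.
-/
import Literature.NumberTheory.ComplexMultiplication.DegenerateCMTypesAbelianKernels
import Literature.NumberTheory.ComplexMultiplication.DegenerateCMTypesAbelianPrimePower
import Literature.NumberTheory.ComplexMultiplication.DegenerateCMTypesCyclicTwoOddPrimes
import HarnessLib

/-!
# Kernels of index `2pq` in a finite abelian group (`p ≠ q` odd primes): the characters vanish on a CM type iff its coset counts are
# ADDITIVELY SEPARABLE along the odd part of the quotient — integer relations among `pq`-th roots of unity

Topic `Literature/NumberTheory/ComplexMultiplication` (namespace `Literature.NumberTheory.ComplexMultiplication.CyclicCMType{,.AbelianKernels}`);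
cell `pub-hodgecm2` (COR-CM), KEPT Literature lane `lit-deligne-3` gen 64, file F64i — the first step of the lane's TWO-ODD-PRIMES programme for
non-cyclic groups (g64 outlook item 2): the kernel decision at index `2pq`, for ANY finite abelian group, in the format of the tree's kernel
decisions (`…iff_of_index_two`, `…of_index_four`, `…equidistributed_of_index` (`2p^{j+1}`), lane `…of_index_four_mul{,_primePow}`).  KERNEL
ONLY: theorems; no `def`, no named fact, no instance, no notation (D-0014 ∕ D-0026 net debt `0`).  HC_CM is NOT proved here or anywhere in the lane.

## Mathematics

T. Kubota [Kubota1965] §4 Lemma 2 reduces the rank of a CM type `S ⊂ G` (finite abelian `G ∋ ρ`) to the vanishing of the odd character sums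
`χ(S)`; grouped by kernels `H = ker χ` (`G/H` cyclic, `ρ ∉ H`) all characters of kernel `H` vanish together (tree
`AbelianKernels.forall_sum_char_eq_zero_iff_exists`).  For `[G:H] = 2pq` (`p ≠ q` odd primes) write `G/H = ⟨ρ̄⟩ × ⟨ū⟩ × ⟨v̄⟩ ≅ ℤ/2 × ℤ/p × ℤ/q` with
`χ(u) = μ`, `χ(v) = ν` primitive of orders `p`, `q`, and `N(c) = #(S ∩ cH)` the coset counts; since `S` is a CM type, `N(ρ̄c) = |H| − N(c)`.  Then
F. Hazama's computation [Hazama2003CyclicCM] (4.1), done with multiplicities,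

  `χ(S) = Σ_{a,b} (N(ū^a v̄^b) − N(ρ̄ ū^a v̄^b)) μ^a ν^b = V(E; μ, ν)`,  `E(a,b) = 2N(ū^a v̄^b) − |H| ∈ ℤ`,

and the INTEGER relations among the `pq`-th roots of unity are the sums of `p`-cycles and `q`-cycles (Rédei ∕ de Bruijn ∕ Schoenberg (4.6);
here, as in the tree's `pairSum_eq_zero_iff`, obtained by averaging the Galois conjugates `ν ↦ ν^b` and the irreducibility of `Φ_p`):
`V(E; μ, ν) = 0 ⟺ E(a,b) − E(a',b) = E(a,b') − E(a',b')` for all `a, a', b, b'` (**`pairSum_eq_zero_iff_forall_sub_eq`**, §1).  Hence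
(**`sum_char_eq_zero_iff_separable_of_index_two_mul_odd_primes`**, §2):

  `χ(S) = 0 ⟺ #(S ∩ gH) + #(S ∩ gxyH) = #(S ∩ gxH) + #(S ∩ gyH)` for all `g ∈ G`, `x` with `x^p ∈ H`, `y` with `y^q ∈ H`

— the coset counts along `ℤ/p × ℤ/q` have no interaction term; and the all-characters form **`forall_sum_char_eq_zero_iff_separable_of_index_two_
mul_odd_primes`** (the kernel contributes `φ(2pq) = (p−1)(q−1)` to Kubota's defect iff so).  For CYCLIC `G` of order `2pq` (`|H| = 1`, `N ∈ {0,1}`)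
separability of a `0/1` matrix means constancy in `a` or in `b`: Hazama's `S₁ = Nonprim` (tree `CyclicCMType.sum_char_eq_zero_iff_isStableUnder`,
Thm. 4.8 (iii)); for `|H| > 1` genuinely mixed patterns `N(a,b) = α(a) + β(b)` occur.

* §1 `pairSum_eq_zero_iff_forall_sub_eq` (integer matrices; the tree's `pairSum`, `pairSum_pow_right_eq_zero`, `sum_mul_pow_eq_zero_iff_forall_eq`
  reused; the averaging lemma re-proved privately since the tree keeps it private).
* §2 private: the parametrisation `Fin 2 × ℤ/p × ℤ/q → G/H`, `t ↦ ρ^e u^a v^b`, is a bijection (injective by cancellation in `μ₂·μ_p·μ_q`: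
  `zmod_eq_of_value_eq_tp`, raise to the power `2q` resp. `2p`; cardinality `2pq = [G:H]`), so every value of `χ` is `(−1)^e μ^a ν^b` and
  `χ(S) = Σ_t N(t)·F(t)` (`Finset.sum_fiberwise_of_maps_to`) `= V(E; μ, ν)`; the opposite fibres by the tree's `AbelianPrimePow.card_filter_neg`,
  `card_fibre_mul`; then §1 and the dictionary value counts ↔ coset counts.

PRESEARCH (lane rule): the `±1` case is Hazama's Lemma 4.6.1 (tree), who cites Schoenberg's theorem (4.6) for the `ℤ`-relations among the `pq`-th
roots of unity (held text `paper:w2141840783`, p. 592); corpus hybrid «vanishing sums of roots of unity pq de Bruijn Schoenberg» (hits: Katz 1990, Lang 1990,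
no page stating the relation module) and galaxy «vanishing sums of roots of unity | de Bruijn | Schoenberg» (all stars: 0 relevant) add no held statement; the
multiplicity form of the CM-type criterion is not found as printed; recorded as the lane's own elementary theorem with [Hazama2003CyclicCM] cited for the
mechanism (the proof here is self-contained: Galois averaging + irreducibility of `Φ_p`).

HONEST REGISTER.  Unconditional and elementary; nothing about degenerate types' Hodge classes.  HC_CM is NOT proved and not used.

## References

* [Hazama2003CyclicCM] F. Hazama, *Hodge cycles on abelian varieties with complex multiplication by cyclic CM-fields*, J. Math. Sci. Univ. Tokyo 10
  (2003) 581–598: (4.1), Prop. 4.1, 4.3, Lemma 4.6.1 with (4.6)–(4.10), Thm. 4.8.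
* [Kubota1965] T. Kubota, *On the field extension by complex multiplication*, Trans. AMS 118 (1965), §4 Lemma 2.
* [White1993SporadicCycles] S. P. White, *Sporadic cycles on CM abelian varieties*, Compositio Math. 88 (1993), §4, proof of Lemma 3 (p. 131).
* [MontgomeryVaughan2007] H. L. Montgomery, R. C. Vaughan, *Multiplicative Number Theory I*, §4.2 (characters of finite abelian groups; via the tree).

## Provenance

Cell `pub-hodgecm2` (COR-CM), KEPT Literature lane `lit-deligne-3` gen 64 (claim ABELIAN-KERNELS-INDEX-2PQ; count-neutral, own lane), file F64i;
neighbours cited by name, nothing restated: `DegenerateCMTypesAbelianKernels` (`forall_sum_char_eq_zero_iff_exists`, `exists_oddChar_ker`),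
`DegenerateCMTypesAbelianPrimePower` (`AbelianPrimePow.card_filter_neg`, `card_fibre_mul`), `DegenerateCMTypesCyclicTwoOddPrimes` (`pairSum`,
`pairSum_pow_right_eq_zero`, `sum_mul_pow_eq_zero_iff_forall_eq`).  The `[folklore]` helpers are private.  Theorems only; net Literature debt 0.
-/

noncomputable section

open scoped BigOperators Classical

namespace Literature.NumberTheory.ComplexMultiplication

namespace CyclicCMType

/-! ## §1 Integer relations `Σ_{x,y} ε(x,y) μˣνʸ = 0` (`μ`, `ν` primitive of orders `p ≠ q`): additive separability -/

section PairInt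

variable {p q : ℕ}

/-- Reindex a sum over `ZMod n` by the representatives `0, …, n − 1`. [folklore] -/
private theorem sum_zmod_eq_sum_range_tp {M : Type*} [AddCommMonoid M] {n : ℕ} [NeZero n] (f : ℕ → M) :
    ∑ k : ZMod n, f k.val = ∑ k ∈ Finset.range n, f k := by
  refine Finset.sum_nbij' (fun k => k.val) (fun k => (k : ZMod n)) ?_ ?_ ?_ ?_ ?_
  · intro k _; exact Finset.mem_range.2 (ZMod.val_lt k)
  · intro k _; exact Finset.mem_univ _
  · intro k _; exact ZMod.natCast_zmod_val k
  · intro k hk; exact ZMod.val_cast_of_lt (Finset.mem_range.1 hk)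
  · intro k _; rfl

/-- `ωᵃ = ω^{a mod q}` when `ω^q = 1`. [folklore] -/
private theorem pow_eq_pow_mod_of_pow_eq_one_tp {ω : ℂ} {q : ℕ} (h : ω ^ q = 1) (a : ℕ) :
    ω ^ a = ω ^ (a % q) := by
  conv_lhs => rw [← Nat.mod_add_div a q, pow_add, pow_mul, h, one_pow, mul_one]

/-- The Ramanujan sum over the non-trivial `q`-th roots (`q` prime, `ν` primitive): `Σ_{b ≠ 0} (νᵇ)ᵗ = q − 1` if `t = 0`, else `−1`.
[folklore] -/
private theorem sum_erase_zero_pow_pow_tp [hq : Fact q.Prime] {ν : ℂ} (hν : IsPrimitiveRoot ν q) (t : ZMod q) :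
    haveI : NeZero q := ⟨hq.out.ne_zero⟩
    ∑ b ∈ (Finset.univ : Finset (ZMod q)).erase 0, (ν ^ b.val) ^ t.val =
      if t = 0 then (q : ℂ) - 1 else -1 := by
  haveI : NeZero q := ⟨hq.out.ne_zero⟩
  have hfull : ∑ b : ZMod q, (ν ^ b.val) ^ t.val = if t = 0 then (q : ℂ) else 0 := by
    have hre : ∀ b : ZMod q, (ν ^ b.val) ^ t.val = (ν ^ t.val) ^ b.val := fun b => by
      rw [← pow_mul, ← pow_mul, mul_comm]
    simp_rw [hre]
    rw [sum_zmod_eq_sum_range_tp (fun k => (ν ^ t.val) ^ k)]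
    by_cases ht : t = 0
    · rw [if_pos ht, ht, ZMod.val_zero, pow_zero]
      simp
    · rw [if_neg ht]
      have htv : t.val ≠ 0 := by rwa [ne_eq, ZMod.val_eq_zero]
      have hω : IsPrimitiveRoot (ν ^ t.val) q :=
        hν.pow_of_coprime t.val (Nat.coprime_of_lt_prime htv (ZMod.val_lt t) hq.out).symm
      exact hω.geom_sum_eq_zero hq.out.one_lt
  rw [← Finset.sum_erase_add _ _ (Finset.mem_univ (0 : ZMod q)), ZMod.val_zero, pow_zero,
    one_pow] at hfull
  split_ifs at hfull ⊢
  · linear_combination hfull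
  · linear_combination hfull

/-- Averaging the Galois conjugates `V(ε; μ, νᵇ) = 0` (`b ≢ 0`) against `ν^{−by'}`: `Σ_x μˣ (q·ε(x,y') − Σ_y ε(x,y)) = 0`.
[cite: Hazama2003CyclicCM, Lemma 4.6.1 (proof)] -/
private theorem sum_pow_mul_rowExcess_eq_zero_tp [hp : Fact p.Prime] [hq : Fact q.Prime] (hpq : p ≠ q)
    {μ ν : ℂ} (hμ : IsPrimitiveRoot μ p) (hν : IsPrimitiveRoot ν q) (ε : ZMod p × ZMod q → ℤ)
    (h0 : haveI : NeZero p := ⟨hp.out.ne_zero⟩; haveI : NeZero q := ⟨hq.out.ne_zero⟩; pairSum ε μ ν = 0)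
    (y' : ZMod q) :
    haveI : NeZero p := ⟨hp.out.ne_zero⟩
    haveI : NeZero q := ⟨hq.out.ne_zero⟩
    ∑ x : ZMod p, μ ^ x.val * ((q : ℂ) * ε (x, y') - ∑ y : ZMod q, (ε (x, y) : ℂ)) = 0 := by
  haveI : NeZero p := ⟨hp.out.ne_zero⟩
  haveI : NeZero q := ⟨hq.out.ne_zero⟩
  set B : Finset (ZMod q) := (Finset.univ : Finset (ZMod q)).erase 0 with hB
  have hvan : ∑ b ∈ B, (ν ^ b.val) ^ (-y').val * pairSum ε μ (ν ^ b.val) = 0 := by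
    refine Finset.sum_eq_zero fun b hb => ?_
    rw [pairSum_pow_right_eq_zero hpq hμ hν ε h0 (Finset.ne_of_mem_erase hb), mul_zero]
  have hsplit : ∀ (b : ZMod q) (y : ZMod q),
      (ν ^ b.val) ^ (y - y').val = (ν ^ b.val) ^ y.val * (ν ^ b.val) ^ (-y').val := by
    intro b y
    have hbq : (ν ^ b.val) ^ q = 1 := by rw [← pow_mul, mul_comm, pow_mul, hν.pow_eq_one, one_pow]
    rw [sub_eq_add_neg, ZMod.val_add, ← pow_eq_pow_mod_of_pow_eq_one_tp hbq, pow_add]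
  have hrow : ∀ x : ZMod p,
      μ ^ x.val * ((q : ℂ) * ε (x, y') - ∑ y : ZMod q, (ε (x, y) : ℂ)) =
        ∑ y : ZMod q, (ε (x, y) : ℂ) * μ ^ x.val *
          ∑ b ∈ B, (ν ^ b.val) ^ y.val * (ν ^ b.val) ^ (-y').val := by
    intro x
    have h1 : ∀ y : ZMod q, ∑ b ∈ B, (ν ^ b.val) ^ y.val * (ν ^ b.val) ^ (-y').val =
        (if y = y' then (q : ℂ) else 0) - 1 := by
      intro y
      simp_rw [← hsplit]
      rw [hB, sum_erase_zero_pow_pow_tp hν (y - y')]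
      by_cases hy : y = y'
      · simp [hy]
      · simp [hy, sub_eq_zero]
    simp_rw [h1, mul_sub, mul_one, Finset.sum_sub_distrib, mul_ite, mul_zero]
    rw [Finset.sum_ite_eq' Finset.univ y', if_pos (Finset.mem_univ _), Finset.mul_sum]
    ring
  rw [Finset.sum_congr rfl fun x _ => hrow x, ← hvan]
  have hR : ∀ b : ZMod q, (ν ^ b.val) ^ (-y').val * pairSum ε μ (ν ^ b.val) =
      ∑ x : ZMod p, ∑ y : ZMod q,
        (ε (x, y) : ℂ) * μ ^ x.val * ((ν ^ b.val) ^ y.val * (ν ^ b.val) ^ (-y').val) := by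
    intro b
    unfold pairSum
    rw [Fintype.sum_prod_type, Finset.mul_sum]
    refine Finset.sum_congr rfl fun x _ => ?_
    rw [Finset.mul_sum]
    refine Finset.sum_congr rfl fun y _ => ?_
    ring
  simp_rw [hR, Finset.mul_sum]
  calc ∑ x : ZMod p, ∑ y : ZMod q, ∑ b ∈ B,
          (ε (x, y) : ℂ) * μ ^ x.val * ((ν ^ b.val) ^ y.val * (ν ^ b.val) ^ (-y').val)
      = ∑ x : ZMod p, ∑ b ∈ B, ∑ y : ZMod q,
          (ε (x, y) : ℂ) * μ ^ x.val * ((ν ^ b.val) ^ y.val * (ν ^ b.val) ^ (-y').val) :=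
        Finset.sum_congr rfl fun x _ => Finset.sum_comm
    _ = ∑ b ∈ B, ∑ x : ZMod p, ∑ y : ZMod q,
          (ε (x, y) : ℂ) * μ ^ x.val * ((ν ^ b.val) ^ y.val * (ν ^ b.val) ^ (-y').val) := Finset.sum_comm

/-- **INTEGER RELATIONS AMONG THE `pq`-TH ROOTS OF UNITY ARE SUMS OF `p`-CYCLES AND `q`-CYCLES** (Rédei ∕ de Bruijn ∕ Schoenberg,
in the form the CM-type analysis uses): for primitive roots of unity `μ` (order `p`) and `ν` (order `q`), `p ≠ q` primes, and an
INTEGER matrix `ε` on `ℤ/p × ℤ/q`, `V(ε; μ, ν) = Σ_{x,y} ε(x,y) μˣνʸ = 0` iff `ε` is ADDITIVELY SEPARABLE: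
`ε(x,y) − ε(x',y) = ε(x,y') − ε(x',y')` for all `x, x', y, y'` (equivalently `ε(x,y) = α(x) + β(y)`).  The tree's
`pairSum_eq_zero_iff` is the `±1`-valued case (Hazama's Lemma 4.6.1: then `ε` is constant in `x` or in `y`); the proof is the same
averaging of Galois conjugates plus the irreducibility of `Φ_p`, stopped before the `±1` analysis.
[cite: Hazama2003CyclicCM, Lemma 4.6.1 and (4.6)–(4.10)] -/
theorem pairSum_eq_zero_iff_forall_sub_eq [hp : Fact p.Prime] [hq : Fact q.Prime] (hpq : p ≠ q) {μ ν : ℂ}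
    (hμ : IsPrimitiveRoot μ p) (hν : IsPrimitiveRoot ν q) (ε : ZMod p × ZMod q → ℤ) :
    haveI : NeZero p := ⟨hp.out.ne_zero⟩
    haveI : NeZero q := ⟨hq.out.ne_zero⟩
    pairSum ε μ ν = 0 ↔
      ∀ (x x' : ZMod p) (y y' : ZMod q), ε (x, y) - ε (x', y) = ε (x, y') - ε (x', y') := by
  haveI : NeZero p := ⟨hp.out.ne_zero⟩
  haveI : NeZero q := ⟨hq.out.ne_zero⟩
  have hμsum : ∑ x : ZMod p, μ ^ x.val = 0 := by
    rw [sum_zmod_eq_sum_range_tp (fun k => μ ^ k), hμ.geom_sum_eq_zero hp.out.one_lt]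
  have hνsum : ∑ y : ZMod q, ν ^ y.val = 0 := by
    rw [sum_zmod_eq_sum_range_tp (fun k => ν ^ k), hν.geom_sum_eq_zero hq.out.one_lt]
  constructor
  · intro h0
    have hconst : ∀ (y' : ZMod q) (x x' : ZMod p),
        (q : ℤ) * ε (x, y') - ∑ y, ε (x, y) = (q : ℤ) * ε (x', y') - ∑ y, ε (x', y) := by
      intro y'
      have h := sum_pow_mul_rowExcess_eq_zero_tp hpq hμ hν ε h0 y'
      have h' : ∑ x : ZMod p, ((((q : ℤ) * ε (x, y') - ∑ y, ε (x, y) : ℤ) : ℚ) : ℂ) * μ ^ x.val = 0 := by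
        rw [← h]
        refine Fintype.sum_congr _ _ fun x => ?_
        push_cast
        ring
      have := (sum_mul_pow_eq_zero_iff_forall_eq hμ _).1 h'
      intro x x'
      exact_mod_cast this x x'
    have hq0 : (q : ℤ) ≠ 0 := by exact_mod_cast hq.out.ne_zero
    intro x x' y y'
    have h1 := hconst y x x'
    have h2 := hconst y' x x'
    have : (q : ℤ) * (ε (x, y) - ε (x', y)) = (q : ℤ) * (ε (x, y') - ε (x', y')) := by linarith
    exact mul_left_cancel₀ hq0 this
  · intro h
    have hdec : ∀ (x : ZMod p) (y : ZMod q),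
        (ε (x, y) : ℂ) = ((ε (x, 0) - ε (0, 0) : ℤ) : ℂ) + ((ε (0, y) : ℤ) : ℂ) := by
      intro x y
      have e : ε (x, y) = (ε (x, 0) - ε (0, 0)) + ε (0, y) := by linarith [h x 0 y 0]
      exact_mod_cast e
    unfold pairSum
    rw [Fintype.sum_prod_type]
    have hx : ∀ x : ZMod p, ∑ y : ZMod q, (ε (x, y) : ℂ) * (μ ^ x.val * ν ^ y.val) =
        μ ^ x.val * ∑ y : ZMod q, ((ε (0, y) : ℤ) : ℂ) * ν ^ y.val := by
      intro x
      have e : ∀ y : ZMod q, (ε (x, y) : ℂ) * (μ ^ x.val * ν ^ y.val) =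
          ((ε (x, 0) - ε (0, 0) : ℤ) : ℂ) * μ ^ x.val * ν ^ y.val + μ ^ x.val * (((ε (0, y) : ℤ) : ℂ) * ν ^ y.val) := by
        intro y; rw [hdec x y]; ring
      rw [Fintype.sum_congr _ _ e, Finset.sum_add_distrib, ← Finset.mul_sum, ← Finset.mul_sum, hνsum, mul_zero,
        zero_add]
    rw [Fintype.sum_congr _ _ hx, ← Finset.sum_mul, hμsum, zero_mul]

end PairInt

namespace AbelianKernels

variable {G : Type*} [CommGroup G] [Fintype G] [DecidableEq G] {ρ : G} {Φ : Finset G} {p q : ℕ}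

/-! ## §0 Helpers -/

section Helpers

omit [Fintype G] [DecidableEq G] in
/-- `χ(gh) = χ(g)χ(h)`. [folklore] -/
private theorem char_mul_tp (χ : AddChar (Additive G) ℂ) (g h : G) :
    χ (Additive.ofMul (g * h)) = χ (Additive.ofMul g) * χ (Additive.ofMul h) := by
  rw [ofMul_mul, AddChar.map_add_eq_mul]

omit [Fintype G] [DecidableEq G] in
/-- `χ(g^e) = χ(g)^e`. [folklore] -/
private theorem char_pow_tp (χ : AddChar (Additive G) ℂ) (g : G) (e : ℕ) :
    χ (Additive.ofMul (g ^ e)) = χ (Additive.ofMul g) ^ e := by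
  rw [ofMul_pow, AddChar.map_nsmul_eq_pow]

omit [Fintype G] [DecidableEq G] in
/-- `χ(1) = 1`. [folklore] -/
private theorem char_one_tp (χ : AddChar (Additive G) ℂ) : χ (Additive.ofMul (1 : G)) = 1 := by
  rw [ofMul_one, AddChar.map_zero_eq_one]

omit [Fintype G] [DecidableEq G] in
/-- `χ(g) ≠ 0`. [folklore] -/
private theorem char_ne_zero_tp (χ : AddChar (Additive G) ℂ) (g : G) : χ (Additive.ofMul g) ≠ 0 := by
  intro h0
  have := char_mul_tp χ g g⁻¹
  rw [mul_inv_cancel, char_one_tp, h0, zero_mul] at this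
  exact one_ne_zero this

omit [Fintype G] [DecidableEq G] in
/-- `χ(s) = χ(g)` iff `g⁻¹s ∈ ker χ`. [folklore] -/
private theorem char_eq_iff_inv_mul_mem_tp {H : Subgroup G} (χ : AddChar (Additive G) ℂ)
    (hker : ∀ g : G, χ (Additive.ofMul g) = 1 ↔ g ∈ H) (g s : G) :
    χ (Additive.ofMul s) = χ (Additive.ofMul g) ↔ g⁻¹ * s ∈ H := by
  rw [← hker]
  have h1 : χ (Additive.ofMul (g⁻¹ * s)) * χ (Additive.ofMul g) = χ (Additive.ofMul s) := by
    rw [← char_mul_tp, mul_comm g⁻¹ s, inv_mul_cancel_right]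
  constructor
  · intro hs
    rw [hs] at h1
    exact mul_left_eq_self₀.1 h1 |>.resolve_right (char_ne_zero_tp χ g)
  · intro h
    rw [h, one_mul] at h1
    exact h1.symm

omit [Fintype G] [DecidableEq G] in
/-- `ρ² = 1` for the conjugation of a CM type. [folklore] -/
private theorem rho_mul_rho_tp (h : IsCMTypeWith ρ (Φ : Set G)) : ρ * ρ = 1 := by
  simpa [smul_eq_mul] using h.invol (1 : G)

omit [Fintype G] [DecidableEq G] in
/-- `χ(g)^{[G : ker χ]} = 1`. [folklore] -/
private theorem char_pow_index_eq_one_tp [Finite G] {H : Subgroup G} (χ : AddChar (Additive G) ℂ)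
    (hker : ∀ g : G, χ (Additive.ofMul g) = 1 ↔ g ∈ H) (g : G) : χ (Additive.ofMul g) ^ H.index = 1 := by
  rw [← char_pow_tp, hker]
  exact Subgroup.pow_index_mem H g

omit [Fintype G] [DecidableEq G] in
/-- A character whose kernel misses the involution `ρ` is odd. [folklore] -/
private theorem odd_of_ker_tp {H : Subgroup G} (hρH : ρ ∉ H) (hρ2 : ρ * ρ = 1) (χ : AddChar (Additive G) ℂ)
    (hker : ∀ g : G, χ (Additive.ofMul g) = 1 ↔ g ∈ H) : χ (Additive.ofMul ρ) = -1 := by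
  have hsq : χ (Additive.ofMul ρ) * χ (Additive.ofMul ρ) = 1 := by rw [← char_mul_tp, hρ2, char_one_tp]
  rcases mul_self_eq_one_iff.1 hsq with h1 | h1
  · exact absurd ((hker ρ).1 h1) hρH
  · exact h1

omit [Fintype G] [DecidableEq G] in
/-- For `ker χ` of index `2pq` with cyclic quotient there are elements whose `χ`-values are primitive `p`-th and `q`-th roots of unity.
[folklore] -/
private theorem exists_isPrimitiveRoot_of_index_tp [Finite G] [hp : Fact p.Prime] [hq : Fact q.Prime] {H : Subgroup G}
    (χ : AddChar (Additive G) ℂ) (hker : ∀ g : G, χ (Additive.ofMul g) = 1 ↔ g ∈ H) (hidx : H.index = 2 * (p * q))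
    (hcyc : IsCyclic (G ⧸ H)) :
    (∃ u : G, IsPrimitiveRoot (χ (Additive.ofMul u)) p) ∧ ∃ v : G, IsPrimitiveRoot (χ (Additive.ofMul v)) q := by
  haveI := hcyc
  obtain ⟨γ, hγ⟩ := IsCyclic.exists_generator (α := G ⧸ H)
  obtain ⟨σ, rfl⟩ := QuotientGroup.mk_surjective γ
  have hσN : orderOf (σ : G ⧸ H) = 2 * (p * q) := by
    rw [orderOf_eq_card_of_forall_mem_zpowers hγ, ← Subgroup.index_eq_card, hidx]
  have hprim : IsPrimitiveRoot (χ (Additive.ofMul σ)) (2 * (p * q)) := by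
    rw [IsPrimitiveRoot.iff_def]
    have hk : ∀ k : ℕ, χ (Additive.ofMul σ) ^ k = 1 ↔ 2 * (p * q) ∣ k := fun k => by
      rw [← char_pow_tp, hker, ← QuotientGroup.eq_one_iff, QuotientGroup.mk_pow, ← hσN, orderOf_dvd_iff_pow_eq_one]
    exact ⟨(hk _).2 dvd_rfl, fun l hl => (hk l).1 hl⟩
  refine ⟨⟨σ ^ (2 * q), ?_⟩, ⟨σ ^ (2 * p), ?_⟩⟩
  · rw [char_pow_tp]
    exact hprim.pow (Nat.mul_pos two_pos (Nat.mul_pos hp.out.pos hq.out.pos)) (by ring)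
  · rw [char_pow_tp]
    exact hprim.pow (Nat.mul_pos two_pos (Nat.mul_pos hp.out.pos hq.out.pos)) (by ring)

/-- `ω^{(x + y).val} = ω^{x.val} ω^{y.val}` for `ω` a primitive `n`-th root of unity. [folklore] -/
private theorem pow_val_add_tp {n : ℕ} [NeZero n] {ω : ℂ} (hω : IsPrimitiveRoot ω n) (x y : ZMod n) :
    ω ^ (x + y).val = ω ^ x.val * ω ^ y.val := by
  have h1 := pow_mod_orderOf ω (x.val + y.val)
  rw [← hω.eq_orderOf] at h1
  rw [ZMod.val_add, h1, pow_add]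

/-- **Cancellation in `μ_2 · μ_p · μ_q`**: `(−1)^e μ^a ν^b = (−1)^{e'} μ^{a'} ν^{b'}` forces `a = a'` (raise to the power `2q`, which is
invertible modulo `p`). [folklore] -/
private theorem zmod_eq_of_value_eq_tp [hp : Fact p.Prime] [hq : Fact q.Prime] (hpq : p ≠ q) (hp2 : p ≠ 2) {μ ν : ℂ}
    (hμ : IsPrimitiveRoot μ p) (hν : IsPrimitiveRoot ν q) {e e' : ℕ} {a a' : ZMod p} {b b' : ZMod q}
    (h : (-1 : ℂ) ^ e * μ ^ a.val * ν ^ b.val = (-1 : ℂ) ^ e' * μ ^ a'.val * ν ^ b'.val) : a = a' := by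
  have hkill : ∀ (f : ℕ) (c : ZMod p) (d : ZMod q), ((-1 : ℂ) ^ f * μ ^ c.val * ν ^ d.val) ^ (2 * q) = μ ^ (2 * q * c.val) := by
    intro f c d
    have A : ((-1 : ℂ) ^ f) ^ (2 * q) = 1 := by
      rw [← pow_mul, show f * (2 * q) = 2 * (f * q) by ring, pow_mul, neg_one_sq, one_pow]
    have B : (ν ^ d.val) ^ (2 * q) = 1 := by
      rw [← pow_mul, show d.val * (2 * q) = q * (2 * d.val) by ring, pow_mul, hν.pow_eq_one, one_pow]
    have C : (μ ^ c.val) ^ (2 * q) = μ ^ (2 * q * c.val) := by rw [← pow_mul, mul_comm]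
    rw [mul_pow, mul_pow, A, B, C, one_mul, mul_one]
  have h2 : μ ^ (2 * q * a.val) = μ ^ (2 * q * a'.val) := by rw [← hkill e a b, ← hkill e' a' b', h]
  have hmod : 2 * q * a.val ≡ 2 * q * a'.val [MOD p] := by
    have h1 := pow_mod_orderOf μ (2 * q * a.val)
    have h1' := pow_mod_orderOf μ (2 * q * a'.val)
    rw [← hμ.eq_orderOf] at h1 h1'
    rw [← h1, ← h1'] at h2
    exact hμ.pow_inj (Nat.mod_lt _ hp.out.pos) (Nat.mod_lt _ hp.out.pos) h2
  have hz : ((2 * q * a.val : ℕ) : ZMod p) = ((2 * q * a'.val : ℕ) : ZMod p) := (ZMod.natCast_eq_natCast_iff _ _ _).2 hmod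
  push_cast at hz
  rw [ZMod.natCast_zmod_val, ZMod.natCast_zmod_val] at hz
  have hu : IsUnit ((2 * q : ℕ) : ZMod p) := by
    rw [ZMod.isUnit_iff_coprime]
    exact Nat.Coprime.mul_left ((Nat.coprime_primes Nat.prime_two hp.out).2 (Ne.symm hp2))
      ((Nat.coprime_primes hq.out hp.out).2 (Ne.symm hpq))
  have hu' : IsUnit ((2 : ZMod p) * (q : ZMod p)) := by exact_mod_cast hu
  exact hu'.mul_left_cancel hz

end Helpers

/-! ## §2 Kernels of index `2pq`: the character sum as `V(E; μ, ν)` and the vanishing criterion -/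

section IndexTwoOddPrimes

variable [hp : Fact p.Prime] [hq : Fact q.Prime]

/-- **VANISHING AT A KERNEL OF INDEX `2pq` IS ADDITIVE SEPARABILITY OF THE COSET COUNTS** (any finite abelian group `G ∋ ρ`, `p ≠ q` odd
primes): let `χ` be a character whose kernel `H ∌ ρ` has index `2pq` and cyclic quotient, and `S` a CM type.  Then `χ(S) = 0` iff

  `#(S ∩ gH) + #(S ∩ gxyH) = #(S ∩ gxH) + #(S ∩ gyH)`  for all `g ∈ G`, all `x` with `x^p ∈ H` and all `y` with `y^q ∈ H`,

i.e. on `G/H ≅ ℤ/2 × ℤ/p × ℤ/q` the coset counts of `S` along the odd part `ℤ/p × ℤ/q` have NO INTERACTION TERM (`N(x,y) = α(x) + β(y)`).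
Mechanism: `χ(S) = V(E; μ, ν)` with `E(a,b) = N(μ^aν^b) − N(−μ^aν^b) = 2N(μ^aν^b) − |H|` (`μ = χ(u)`, `ν = χ(v)` primitive of orders
`p`, `q`), and §1.  For `|H| = 1` (cyclic `G` of order `2pq`, `N ∈ {0,1}`) separability forces `N` constant in `x` or in `y` — Hazama's
`S₁` = the types stable under `ℤ/p` or `ℤ/q` (tree `sum_char_eq_zero_iff_isStableUnder`). [cite: Hazama2003CyclicCM, Prop. 4.1, Lemma 4.6.1,
Thm. 4.8] [cite: Kubota1965, §4 Lemma 2] -/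
theorem sum_char_eq_zero_iff_separable_of_index_two_mul_odd_primes (hpq : p ≠ q) (hp2 : p ≠ 2) (hq2 : q ≠ 2)
    (h : IsCMTypeWith ρ (Φ : Set G)) (χ : AddChar (Additive G) ℂ) {H : Subgroup G} (hρH : ρ ∉ H)
    (hker : ∀ g : G, χ (Additive.ofMul g) = 1 ↔ g ∈ H) (hidx : H.index = 2 * (p * q)) (hcyc : IsCyclic (G ⧸ H)) :
    ∑ s ∈ Φ, χ (Additive.ofMul s) = 0 ↔ ∀ g x y : G, x ^ p ∈ H → y ^ q ∈ H →
      (Φ.filter fun s => g⁻¹ * s ∈ H).card + (Φ.filter fun s => (g * x * y)⁻¹ * s ∈ H).card =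
        (Φ.filter fun s => (g * x)⁻¹ * s ∈ H).card + (Φ.filter fun s => (g * y)⁻¹ * s ∈ H).card := by
  haveI : NeZero p := ⟨hp.out.ne_zero⟩
  haveI : NeZero q := ⟨hq.out.ne_zero⟩
  have hρ2 := rho_mul_rho_tp h
  have hχρ : χ (Additive.ofMul ρ) = -1 := odd_of_ker_tp hρH hρ2 χ hker
  obtain ⟨⟨u, hu⟩, ⟨v, hv⟩⟩ := exists_isPrimitiveRoot_of_index_tp χ hker hidx hcyc
  -- notation-free abbreviations
  have hμ0 : ∀ a : ℕ, χ (Additive.ofMul u) ^ a ≠ 0 := fun a => pow_ne_zero _ (char_ne_zero_tp χ u)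
  have hν0 : ∀ b : ℕ, χ (Additive.ofMul v) ^ b ≠ 0 := fun b => pow_ne_zero _ (char_ne_zero_tp χ v)
  -- the coset counts as value counts
  have hcos : ∀ g : G, (Φ.filter fun s => g⁻¹ * s ∈ H) =
      Φ.filter fun s => χ (Additive.ofMul s) = χ (Additive.ofMul g) := fun g =>
    Finset.filter_congr fun s _ => (char_eq_iff_inv_mul_mem_tp χ hker g s).symm
  -- the values `χ(u^a v^b) = μ^a ν^b`
  have hval : ∀ (a : ZMod p) (b : ZMod q), χ (Additive.ofMul (u ^ a.val * v ^ b.val)) =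
      χ (Additive.ofMul u) ^ a.val * χ (Additive.ofMul v) ^ b.val := fun a b => by
    rw [char_mul_tp, char_pow_tp, char_pow_tp]
  -- the fibre sizes over the values `±μ^aν^b` are all `M := #χ⁻¹(1)`
  have hM : ∀ (a : ZMod p) (b : ZMod q),
      (Finset.univ.filter fun t : G => χ (Additive.ofMul t) = χ (Additive.ofMul u) ^ a.val * χ (Additive.ofMul v) ^ b.val).card =
        (Finset.univ.filter fun t : G => χ (Additive.ofMul t) = 1).card := fun a b => by
    rw [← hval, ← AbelianPrimePow.card_fibre_mul χ (u ^ a.val * v ^ b.val) 1, mul_one]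
  have hneg : ∀ (a : ZMod p) (b : ZMod q),
      (Φ.filter fun s => χ (Additive.ofMul s) = -(χ (Additive.ofMul u) ^ a.val * χ (Additive.ofMul v) ^ b.val)).card =
        (Finset.univ.filter fun t : G => χ (Additive.ofMul t) = 1).card -
          (Φ.filter fun s => χ (Additive.ofMul s) = χ (Additive.ofMul u) ^ a.val * χ (Additive.ofMul v) ^ b.val).card := by
    intro a b
    rw [AbelianPrimePow.card_filter_neg h χ hχρ, hM]
  have hle : ∀ (a : ZMod p) (b : ZMod q),
      (Φ.filter fun s => χ (Additive.ofMul s) = χ (Additive.ofMul u) ^ a.val * χ (Additive.ofMul v) ^ b.val).card ≤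
        (Finset.univ.filter fun t : G => χ (Additive.ofMul t) = 1).card := fun a b => by
    rw [← hM a b]
    exact Finset.card_le_card (Finset.filter_subset_filter _ (Finset.subset_univ Φ))
  -- §A  the character sum is `V(E; μ, ν)` with `E(a,b) = N(μ^aν^b) − N(−μ^aν^b)`
  set E : ZMod p × ZMod q → ℤ := fun ab =>
    ((Φ.filter fun s => χ (Additive.ofMul s) = χ (Additive.ofMul u) ^ ab.1.val * χ (Additive.ofMul v) ^ ab.2.val).card : ℤ) -
      ((Φ.filter fun s => χ (Additive.ofMul s) =
        -(χ (Additive.ofMul u) ^ ab.1.val * χ (Additive.ofMul v) ^ ab.2.val)).card : ℤ) with hE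
  -- the parametrisation of `G/H` by `Fin 2 × ℤ/p × ℤ/q`
  set w : Fin 2 × ZMod p × ZMod q → G := fun t => ρ ^ (t.1 : ℕ) * (u ^ t.2.1.val * v ^ t.2.2.val) with hw
  set F : Fin 2 × ZMod p × ZMod q → ℂ := fun t =>
    (-1 : ℂ) ^ (t.1 : ℕ) * χ (Additive.ofMul u) ^ t.2.1.val * χ (Additive.ofMul v) ^ t.2.2.val with hF
  have hFw : ∀ t, χ (Additive.ofMul (w t)) = F t := fun t => by
    rw [hw, hF]
    dsimp only
    rw [char_mul_tp, char_pow_tp, hχρ, hval, mul_assoc]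
  have hFinj : Function.Injective F := by
    rintro ⟨e, a, b⟩ ⟨e', a', b'⟩ hFF
    rw [hF] at hFF
    dsimp only at hFF
    have ha : a = a' := zmod_eq_of_value_eq_tp hpq hp2 hu hv hFF
    have hb : b = b' := by
      have hFF' : (-1 : ℂ) ^ (e : ℕ) * χ (Additive.ofMul v) ^ b.val * χ (Additive.ofMul u) ^ a.val =
          (-1 : ℂ) ^ (e' : ℕ) * χ (Additive.ofMul v) ^ b'.val * χ (Additive.ofMul u) ^ a'.val := by
        rw [mul_assoc, mul_comm (χ (Additive.ofMul v) ^ b.val), ← mul_assoc, hFF, mul_assoc, mul_assoc,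
          mul_comm (χ (Additive.ofMul u) ^ a'.val)]
      exact zmod_eq_of_value_eq_tp (Ne.symm hpq) hq2 hv hu hFF'
    subst ha; subst hb
    have hε : (-1 : ℂ) ^ (e : ℕ) = (-1 : ℂ) ^ (e' : ℕ) :=
      mul_right_cancel₀ (hμ0 _) (mul_right_cancel₀ (hν0 _) hFF)
    have hee : e = e' := by
      by_contra hne
      have h01 : ((e : ℕ) = 0 ∧ (e' : ℕ) = 1) ∨ ((e : ℕ) = 1 ∧ (e' : ℕ) = 0) := by
        have h1 := e.isLt; have h2 := e'.isLt; have h3 : (e : ℕ) ≠ e' := fun h => hne (Fin.ext h); omega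
      rcases h01 with ⟨h0, h1⟩ | ⟨h0, h1⟩ <;> rw [h0, h1] at hε <;> norm_num at hε
    rw [hee]
  have hwinj : Function.Injective (fun t => (w t : G ⧸ H)) := by
    intro t t' htt
    have hmem : (w t)⁻¹ * w t' ∈ H := QuotientGroup.eq.1 htt
    have hχeq : χ (Additive.ofMul (w t')) = χ (Additive.ofMul (w t)) := (char_eq_iff_inv_mul_mem_tp χ hker _ _).2 hmem
    rw [hFw, hFw] at hχeq
    exact (hFinj hχeq).symm
  have hcard : Fintype.card (Fin 2 × ZMod p × ZMod q) = Fintype.card (G ⧸ H) := by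
    rw [← Nat.card_eq_fintype_card (α := G ⧸ H), ← Subgroup.index_eq_card, hidx]
    simp [Fintype.card_prod, ZMod.card]
  have hwbij : Function.Bijective (fun t => (w t : G ⧸ H)) :=
    (Fintype.bijective_iff_injective_and_card _).2 ⟨hwinj, hcard⟩
  -- every value of `χ` is some `F t`, and the fibres of `t ↦ F t` are the value fibres
  have hexists : ∀ s : G, ∃ t, χ (Additive.ofMul s) = F t := fun s => by
    obtain ⟨t, ht⟩ := hwbij.2 (s : G ⧸ H)
    refine ⟨t, ?_⟩
    rw [← hFw]
    exact (char_eq_iff_inv_mul_mem_tp χ hker (w t) s).2 (QuotientGroup.eq.1 ht)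
  have hsumF : ∑ s ∈ Φ, χ (Additive.ofMul s) =
      ∑ t : Fin 2 × ZMod p × ZMod q, ((Φ.filter fun s => χ (Additive.ofMul s) = F t).card : ℂ) * F t := by
    rw [← Finset.sum_fiberwise_of_maps_to (s := Φ) (t := Finset.univ)
      (g := fun s => Classical.choose (hexists s)) (fun s _ => Finset.mem_univ _) (fun s => χ (Additive.ofMul s))]
    refine Finset.sum_congr rfl fun t _ => ?_
    have hfib : (Φ.filter fun s => Classical.choose (hexists s) = t) = Φ.filter fun s => χ (Additive.ofMul s) = F t := by
      refine Finset.filter_congr fun s _ => ⟨fun hs => ?_, fun hs => ?_⟩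
      · rw [← hs]; exact Classical.choose_spec (hexists s)
      · exact hFinj ((Classical.choose_spec (hexists s)).symm.trans hs)
    rw [hfib, Finset.sum_congr rfl fun s hs => (Finset.mem_filter.1 hs).2, Finset.sum_const, nsmul_eq_mul]
  have hpair : ∑ s ∈ Φ, χ (Additive.ofMul s) = pairSum E (χ (Additive.ofMul u)) (χ (Additive.ofMul v)) := by
    rw [hsumF, Fintype.sum_prod_type, Fin.sum_univ_two]
    unfold pairSum
    rw [← Finset.sum_add_distrib]
    refine Finset.sum_congr rfl fun ab _ => ?_
    rw [hE, hF]
    dsimp only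
    push_cast
    simp only [Fin.val_zero, Fin.val_one, pow_zero, pow_one, one_mul, neg_one_mul]
    ring
  -- §B  the criterion in value form
  rw [hpair, pairSum_eq_zero_iff_forall_sub_eq hpq hu hv E]
  have hEval : ∀ (a : ZMod p) (b : ZMod q), E (a, b) =
      2 * ((Φ.filter fun s => χ (Additive.ofMul s) = χ (Additive.ofMul u) ^ a.val * χ (Additive.ofMul v) ^ b.val).card : ℤ) -
        ((Finset.univ.filter fun t : G => χ (Additive.ofMul t) = 1).card : ℤ) := by
    intro a b
    rw [hE]
    dsimp only
    have h1 := hneg a b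
    have h2 := hle a b
    omega
  -- §C  value counts versus coset counts
  have hN : ∀ (g : G), (Φ.filter fun s => g⁻¹ * s ∈ H).card =
      (Φ.filter fun s => χ (Additive.ofMul s) = χ (Additive.ofMul g)).card := fun g => by rw [hcos]
  constructor
  · intro hsep g x y hx hy
    -- `χ(x) = μ^i`, `χ(y) = ν^j`
    have hxp : χ (Additive.ofMul x) ^ p = 1 := by rw [← char_pow_tp, hker]; exact hx
    have hyq : χ (Additive.ofMul y) ^ q = 1 := by rw [← char_pow_tp, hker]; exact hy
    obtain ⟨i, hi, hix⟩ := hu.eq_pow_of_pow_eq_one hxp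
    obtain ⟨j, hj, hjy⟩ := hv.eq_pow_of_pow_eq_one hyq
    have hiv : χ (Additive.ofMul u) ^ i = χ (Additive.ofMul u) ^ ((i : ZMod p)).val := by rw [ZMod.val_natCast_of_lt hi]
    have hjv : χ (Additive.ofMul v) ^ j = χ (Additive.ofMul v) ^ ((j : ZMod q)).val := by rw [ZMod.val_natCast_of_lt hj]
    obtain ⟨⟨e, a, b⟩, ht⟩ := hexists g
    rw [hF] at ht
    dsimp only at ht
    -- the four values
    have vg : χ (Additive.ofMul g) = (-1 : ℂ) ^ (e : ℕ) * (χ (Additive.ofMul u) ^ a.val * χ (Additive.ofMul v) ^ b.val) := by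
      rw [ht, mul_assoc]
    have vgx : χ (Additive.ofMul (g * x)) =
        (-1 : ℂ) ^ (e : ℕ) * (χ (Additive.ofMul u) ^ (a + (i : ZMod p)).val * χ (Additive.ofMul v) ^ b.val) := by
      rw [char_mul_tp, ht, ← hix, hiv, pow_val_add_tp hu]; ring
    have vgy : χ (Additive.ofMul (g * y)) =
        (-1 : ℂ) ^ (e : ℕ) * (χ (Additive.ofMul u) ^ a.val * χ (Additive.ofMul v) ^ (b + (j : ZMod q)).val) := by
      rw [char_mul_tp, ht, ← hjy, hjv, pow_val_add_tp hv]; ring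
    have vgxy : χ (Additive.ofMul (g * x * y)) =
        (-1 : ℂ) ^ (e : ℕ) * (χ (Additive.ofMul u) ^ (a + (i : ZMod p)).val * χ (Additive.ofMul v) ^ (b + (j : ZMod q)).val) := by
      rw [char_mul_tp, char_mul_tp, ht, ← hix, ← hjy, hiv, hjv, pow_val_add_tp hu, pow_val_add_tp hv]; ring
    have key := hsep a (a + (i : ZMod p)) b (b + (j : ZMod q))
    rw [hEval, hEval, hEval, hEval] at key
    rw [hN, hN, hN, hN, vg, vgx, vgy, vgxy]
    rcases Fin.exists_fin_two.1 ⟨e, rfl⟩ with he | he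
    · simp only [he, Fin.val_zero, pow_zero, one_mul]
      omega
    · simp only [he, Fin.val_one, pow_one, neg_one_mul]
      have n1 := hneg a b; have n2 := hneg (a + (i : ZMod p)) b; have n3 := hneg a (b + (j : ZMod q))
      have n4 := hneg (a + (i : ZMod p)) (b + (j : ZMod q))
      have l1 := hle a b; have l2 := hle (a + (i : ZMod p)) b; have l3 := hle a (b + (j : ZMod q))
      have l4 := hle (a + (i : ZMod p)) (b + (j : ZMod q))
      omega
  · intro hcoset a a' b b'
    have hx : (u ^ (a' - a).val) ^ p ∈ H := by
      rw [← hker, char_pow_tp, char_pow_tp, ← pow_mul, mul_comm, pow_mul, hu.pow_eq_one, one_pow]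
    have hy : (v ^ (b' - b).val) ^ q ∈ H := by
      rw [← hker, char_pow_tp, char_pow_tp, ← pow_mul, mul_comm, pow_mul, hv.pow_eq_one, one_pow]
    have key := hcoset (u ^ a.val * v ^ b.val) (u ^ (a' - a).val) (v ^ (b' - b).val) hx hy
    have e1 : χ (Additive.ofMul (u ^ a.val * v ^ b.val * u ^ (a' - a).val)) =
        χ (Additive.ofMul u) ^ a'.val * χ (Additive.ofMul v) ^ b.val := by
      rw [char_mul_tp, hval, char_pow_tp, mul_right_comm, ← pow_val_add_tp hu, add_sub_cancel]
    have e2 : χ (Additive.ofMul (u ^ a.val * v ^ b.val * v ^ (b' - b).val)) =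
        χ (Additive.ofMul u) ^ a.val * χ (Additive.ofMul v) ^ b'.val := by
      rw [char_mul_tp, hval, char_pow_tp, mul_assoc, ← pow_val_add_tp hv, add_sub_cancel]
    have e3 : χ (Additive.ofMul (u ^ a.val * v ^ b.val * u ^ (a' - a).val * v ^ (b' - b).val)) =
        χ (Additive.ofMul u) ^ a'.val * χ (Additive.ofMul v) ^ b'.val := by
      rw [char_mul_tp, e1, char_pow_tp, mul_assoc, ← pow_val_add_tp hv, add_sub_cancel]
    rw [hN, hN, hN, hN, hval, e1, e2, e3] at key
    rw [hEval, hEval, hEval, hEval]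
    linarith [key]

omit [DecidableEq G] in
/-- **All characters of an index-`2pq` kernel at once**: for `H ∌ ρ` with `G/H` cyclic of order `2pq` (`p ≠ q` odd primes), the
`φ(2pq) = (p−1)(q−1)` characters with kernel `H` vanish on `S` iff the coset counts of `S` are additively separable along the odd part of
`G/H` (so `H` contributes `(p−1)(q−1)` to Kubota's defect iff so). [cite: Kubota1965, §4 Lemma 2] [cite: Hazama2003CyclicCM, Thm. 4.8]
[cite: White1993SporadicCycles, §4, proof of Lemma 3 (p. 131)] -/
theorem forall_sum_char_eq_zero_iff_separable_of_index_two_mul_odd_primes (hpq : p ≠ q) (hp2 : p ≠ 2) (hq2 : q ≠ 2)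
    (h : IsCMTypeWith ρ (Φ : Set G)) {H : Subgroup G} (hρH : ρ ∉ H) (hcyc : IsCyclic (G ⧸ H))
    (hidx : H.index = 2 * (p * q)) :
    (∀ χ : AddChar (Additive G) ℂ, (∀ g : G, χ (Additive.ofMul g) = 1 ↔ g ∈ H) →
        ∑ s ∈ Φ, χ (Additive.ofMul s) = 0) ↔
      ∀ g x y : G, x ^ p ∈ H → y ^ q ∈ H →
        (Φ.filter fun s => g⁻¹ * s ∈ H).card + (Φ.filter fun s => (g * x * y)⁻¹ * s ∈ H).card =
          (Φ.filter fun s => (g * x)⁻¹ * s ∈ H).card + (Φ.filter fun s => (g * y)⁻¹ * s ∈ H).card := by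
  have hρ2 := rho_mul_rho_tp h
  rw [forall_sum_char_eq_zero_iff_exists hρH hρ2 hcyc Φ]
  constructor
  · rintro ⟨ψ, hψ, h0⟩
    exact (sum_char_eq_zero_iff_separable_of_index_two_mul_odd_primes hpq hp2 hq2 h ψ hρH hψ hidx hcyc).1 h0
  · intro hsep
    obtain ⟨χ, -, hker⟩ := exists_oddChar_ker hρH hρ2 hcyc
    exact ⟨χ, hker, (sum_char_eq_zero_iff_separable_of_index_two_mul_odd_primes hpq hp2 hq2 h χ hρH hker hidx hcyc).2 hsep⟩

end IndexTwoOddPrimes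

end AbelianKernels

end CyclicCMType

end Literature.NumberTheory.ComplexMultiplication

end
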